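import Summits.Ventures.PercRepro.Night2FatDegSmallB
import Summits.Ventures.PercRepro.Night2FatDegLargeB
import Summits.Ventures.PercRepro.Night2FatZAll

/-!
# night-2: the singly degenerate regime is closed — every lossy basis pair, and the local Hall inequality

* **`basis_pair_fair_fat_deg`**: every lossy basis pair of the singly degenerate two-planes regime (the points of `π₂`
  off the spine of rank `≥ 3`, those of `π₃` off the spine collinear) has the fair share — `N ≥ 6` always
  (`|V| = N + 3 ≥ 9`: three points on the spine, three in each plane off it), `N ≥ 9` by
  `basis_pair_fair_fat_deg_nine_le`, `N = 6, 7, 8` by `basis_pair_fair_fat_deg_small`;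
* **`localShadowHall_fat_of_two_planes_singly_deg`**: the local Hall inequality of the cell in the singly degenerate
  regime (either plane degenerate, by the symmetry `c₂ ↔ c₃`);
* **`localShadowHall_fat_of_not_doubly_deg`**: THE FAT CASE OF (FAIR) UNDER THE HYPOTHESIS (NDD) — for every line
  `R` of `H₀` coplanar with the off-points and every plane `clF (insert c R)` through it, the points of `H₀` outside
  that plane OR the points of that plane off `R` have rank `≥ 3` (no lossy big pair without good points has BOTH planes
  degenerate).  Compared with `localShadowHall_fat_of_hnd` this leaves, of the whole fat case, only the DOUBLY
  degenerate regime (`H₀` = three lines).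
Paper `proofs/NIGHT-2-g35.md` §6.
-/

namespace PercRepro.Shadow

open PercRepro.ThmH PercRepro.PerFlat

variable {α : Type*} [DecidableEq α] {M : Matroid α} [M.Finite] {G : Finset α}

/-- **The fair share of every lossy basis pair of the singly degenerate regime.** -/
theorem basis_pair_fair_fat_deg (hG : G ∈ flatsQ M (5 + 1)) (hd : (gr M \ G).card = 2)
    (hk : kColoops M G = 1) (hs : ∀ e ∈ gr M, ∀ f ∈ gr M, e ≠ f → rkN M {e, f} = 2)
    (hl : ∀ e ∈ gr M, M.Indep {e}) (hfat : (fatClosures M 5 G 2).card ≤ 1) {B₀ : Finset α}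
    (hB₀ : B₀ ∈ thinMembers M 5 G) {w₀ x : α} (hD : G \ clF M B₀ = {w₀, x}) (hne : w₀ ≠ x) {R₁ : Finset α}
    (hR₁V : R₁ ⊆ (G \ coloops M G) \ {w₀, x}) (hR₁2 : rkN M R₁ = 2) (hR₁3 : 3 ≤ R₁.card)
    (hcop : rkN M (insert w₀ (insert x R₁)) ≤ 3) {c₂ c₃ : α}
    (hc₂V : c₂ ∈ (G \ coloops M G) \ {w₀, x}) (hc₃V : c₃ ∈ (G \ coloops M G) \ {w₀, x})
    (hc₂ : c₂ ∉ clF M R₁) (hc₃ : c₃ ∉ clF M (insert c₂ R₁))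
    (hcover : ∀ e ∈ (G \ coloops M G) \ {w₀, x}, e ∈ clF M (insert c₂ R₁) ∨ e ∈ clF M (insert c₃ R₁))
    (hnd₂ : 3 ≤ rkN M (((G \ coloops M G) \ {w₀, x}).filter
      (fun e => e ∈ clF M (insert c₂ R₁) ∧ e ∉ clF M R₁)))
    (hdeg₃ : rkN M (((G \ coloops M G) \ {w₀, x}).filter
      (fun e => e ∈ clF M (insert c₃ R₁) ∧ e ∉ clF M R₁)) ≤ 2)
    {B : Finset α} (hB : B ∈ thinMembers M 5 G) (hnP : ¬ bigP M G B) {z : α} (hz : z ∈ G \ clF M B)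
    (hl0 : loss M 5 G B z ≠ 0) (hw₀ : w₀ ∈ insert z B) (hx : x ∉ insert z B) :
    loss M 5 G B z ≤ rhoL M 5 G B z * lossIncomeH M 5 G (bigP M G) (dshGT2 M 5 G) B z := by
  -- `N ≥ 6`: `V = P₀ ∪ W′` has `≥ 9` points
  have hN6 : 6 ≤ (G \ insert z B).card := by
    have hGg : G ⊆ gr M := (mem_flatsQ.1 hG).1
    set V := (G \ coloops M G) \ {w₀, x} with hV
    have hVg : V ⊆ gr M := fun e he => hGg (Finset.mem_sdiff.1 (Finset.mem_sdiff.1 he).1).1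
    have hR₁g : R₁ ⊆ gr M := hR₁V.trans hVg
    have hc₂g : c₂ ∈ gr M := hVg hc₂V
    have hc₃g : c₃ ∈ gr M := hVg hc₃V
    set Lset := V.filter (fun e => e ∈ clF M R₁) with hLset
    set Aset := V.filter (fun e => e ∈ clF M (insert c₂ R₁) ∧ e ∉ clF M R₁) with hAset
    set Mset := V.filter (fun e => e ∈ clF M (insert c₃ R₁) ∧ e ∉ clF M R₁) with hMset
    have hL3 : 3 ≤ Lset.card := by
      have hsub : R₁ ⊆ Lset := fun e he => Finset.mem_filter.2 ⟨hR₁V he, subset_clF_of_subset_gr hR₁g he⟩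
      exact hR₁3.trans (Finset.card_le_card hsub)
    have hA3 : 3 ≤ Aset.card := hnd₂.trans (rkN_le_card _)
    have hM3 : 3 ≤ Mset.card := three_le_card_side_of_fat hG hd hk hs hfat hB₀ hD hne hR₁V hR₁2 hR₁3 hcop hc₂V
      hc₃V hc₂ hc₃ hcover
    have hunion : Lset ∪ (Aset ∪ Mset) ⊆ V :=
      Finset.union_subset (Finset.filter_subset _ _)
        (Finset.union_subset (Finset.filter_subset _ _) (Finset.filter_subset _ _))
    have hd1 : Disjoint Lset (Aset ∪ Mset) := by
      rw [Finset.disjoint_left]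
      intro e he₁ he₂
      rw [Finset.mem_union] at he₂
      rcases he₂ with h | h
      · exact (Finset.mem_filter.1 h).2.2 (Finset.mem_filter.1 he₁).2
      · exact (Finset.mem_filter.1 h).2.2 (Finset.mem_filter.1 he₁).2
    have hd2 : Disjoint Aset Mset := by
      rw [Finset.disjoint_left]
      intro e he₁ he₂
      exact (Finset.mem_filter.1 he₁).2.2 (mem_clF_of_mem_two_planes hR₁g hc₂g hc₃g hc₂ hc₃
        (Finset.mem_filter.1 he₁).2.1 (Finset.mem_filter.1 he₂).2.1)
    have h9 : 9 ≤ V.card := by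
      have := Finset.card_le_card hunion
      rw [Finset.card_union_of_disjoint hd1, Finset.card_union_of_disjoint hd2] at this
      omega
    -- `V = P₀ ∪ W′`
    have hPV := basis_points_subset_V (w₀ := w₀) hB hz hx
    have hWV := W_subset_V (x := x) hG hd hB hw₀
    have hP4 := card_basis_points hG hd hk hB₀ hD hB hnP hz hw₀
    have hcov : V ⊆ (insert z B \ coloops M G).erase w₀ ∪ (G \ insert z B).erase x := by
      intro e he
      rw [Finset.mem_union]
      exact mem_basis_or_W_of_mem_V he
    have h1 := Finset.card_le_card hcov
    have h2 := Finset.card_union_le ((insert z B \ coloops M G).erase w₀) ((G \ insert z B).erase x)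
    have hxG : x ∈ G \ insert z B := by
      refine Finset.mem_sdiff.2 ⟨?_, hx⟩
      have : x ∈ G \ clF M B₀ := by
        rw [hD]
        exact Finset.mem_insert_of_mem (Finset.mem_singleton_self _)
      exact (Finset.mem_sdiff.1 this).1
    have h3 : ((G \ insert z B).erase x).card + 1 = (G \ insert z B).card := by
      rw [Finset.card_erase_of_mem hxG]
      have : 0 < (G \ insert z B).card := Finset.card_pos.2 ⟨x, hxG⟩
      omega
    omega
  rcases Nat.lt_or_ge (G \ insert z B).card 9 with h8 | h9
  · exact basis_pair_fair_fat_deg_small hG hd hk hs hl hfat hB₀ hD hne hR₁V hR₁2 hR₁3 hcop hc₂V hc₃V hc₂ hc₃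
      hcover hnd₂ hdeg₃ hB hnP hz hl0 hw₀ hx hN6 (by omega)
  · exact basis_pair_fair_fat_deg_nine_le hG hd hk hs hl hfat hB₀ hD hne hR₁V hR₁2 hR₁3 hcop hc₂V hc₃V hc₂ hc₃
      hcover hnd₂ hdeg₃ hB hnP hz hl0 hw₀ hx h9

/-- **The local Hall inequality of the cell in the singly degenerate two-planes regime** (`π₃` degenerate). -/
theorem localShadowHall_fat_of_two_planes_singly_deg (hG : G ∈ flatsQ M (5 + 1)) (hd : (gr M \ G).card = 2)
    (hk : kColoops M G = 1) (hs : ∀ e ∈ gr M, ∀ f ∈ gr M, e ≠ f → rkN M {e, f} = 2)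
    (hl : ∀ e ∈ gr M, M.Indep {e}) (hfat : (fatClosures M 5 G 2).card ≤ 1)
    {B₀ : Finset α} (hB₀ : B₀ ∈ thinMembers M 5 G) {w₀ x : α} (hD : G \ clF M B₀ = {w₀, x}) (hne : w₀ ≠ x)
    {R₁ : Finset α}
    (hR₁V : R₁ ⊆ (G \ coloops M G) \ {w₀, x}) (hR₁2 : rkN M R₁ = 2) (hR₁3 : 3 ≤ R₁.card)
    (hcop : rkN M (insert w₀ (insert x R₁)) ≤ 3) {c₂ c₃ : α}
    (hc₂V : c₂ ∈ (G \ coloops M G) \ {w₀, x}) (hc₃V : c₃ ∈ (G \ coloops M G) \ {w₀, x})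
    (hc₂ : c₂ ∉ clF M R₁) (hc₃ : c₃ ∉ clF M (insert c₂ R₁))
    (hcover : ∀ e ∈ (G \ coloops M G) \ {w₀, x}, e ∈ clF M (insert c₂ R₁) ∨ e ∈ clF M (insert c₃ R₁))
    (hnd₂ : 3 ≤ rkN M (((G \ coloops M G) \ {w₀, x}).filter
      (fun e => e ∈ clF M (insert c₂ R₁) ∧ e ∉ clF M R₁)))
    (hdeg₃ : rkN M (((G \ coloops M G) \ {w₀, x}).filter
      (fun e => e ∈ clF M (insert c₃ R₁) ∧ e ∉ clF M R₁)) ≤ 2) :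
    LocalShadowHall M 5 G := by
  apply localShadowHall_of_gt2_of_basis_fair hG hd hk hs hl hfat
  intro B hB hnP z hz
  have hd' : (gr M \ G).card ≤ 5 := by omega
  by_cases hl0 : loss M 5 G B z = 0
  · rw [hl0]
    have h1 : 0 ≤ rhoL M 5 G B z := by
      unfold rhoL
      rw [hl0]
      simp
    have h2 : 0 ≤ lossIncomeH M 5 G (bigP M G) (dshGT2 M 5 G) B z :=
      lossIncomeH_nonneg hG hd' (column_side_gt2 hG hd hk hs hl hfat) B z
    positivity
  · have hm₀ : (G \ clF M B₀).card = 2 := by rw [hD, Finset.card_pair hne]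
    obtain ⟨u, v, hD', hne', hu, hv⟩ := exists_fat_split hG hd hk hB₀ hm₀ hB hz hl0
    have hpair : ({u, v} : Finset α) = {w₀, x} := by rw [← hD', hD]
    have hR₁V' : R₁ ⊆ (G \ coloops M G) \ {u, v} := by rw [hpair]; exact hR₁V
    have hc₂V' : c₂ ∈ (G \ coloops M G) \ {u, v} := by rw [hpair]; exact hc₂V
    have hc₃V' : c₃ ∈ (G \ coloops M G) \ {u, v} := by rw [hpair]; exact hc₃V
    have hcover' : ∀ e ∈ (G \ coloops M G) \ {u, v}, e ∈ clF M (insert c₂ R₁) ∨ e ∈ clF M (insert c₃ R₁) := by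
      rw [hpair]; exact hcover
    have hnd₂' : 3 ≤ rkN M (((G \ coloops M G) \ {u, v}).filter
        (fun e => e ∈ clF M (insert c₂ R₁) ∧ e ∉ clF M R₁)) := by rw [hpair]; exact hnd₂
    have hdeg₃' : rkN M (((G \ coloops M G) \ {u, v}).filter
        (fun e => e ∈ clF M (insert c₃ R₁) ∧ e ∉ clF M R₁)) ≤ 2 := by rw [hpair]; exact hdeg₃
    have hcop' : rkN M (insert u (insert v R₁)) ≤ 3 := by
      have heq : insert u (insert v R₁) = insert w₀ (insert x R₁) := by
        have h1 : insert u (insert v R₁) = ({u, v} : Finset α) ∪ R₁ := by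
          ext e
          simp only [Finset.mem_insert, Finset.mem_union, Finset.mem_singleton]
          tauto
        have h2 : insert w₀ (insert x R₁) = ({w₀, x} : Finset α) ∪ R₁ := by
          ext e
          simp only [Finset.mem_insert, Finset.mem_union, Finset.mem_singleton]
          tauto
        rw [h1, h2, hpair]
      rw [heq]
      exact hcop
    exact basis_pair_fair_fat_deg hG hd hk hs hl hfat hB₀ hD' hne' hR₁V' hR₁2 hR₁3 hcop' hc₂V' hc₃V' hc₂ hc₃
      hcover' hnd₂' hdeg₃' hB hnP hz hl0 hu hv

/-- **THE FAT CASE OF (FAIR) UNDER THE HYPOTHESIS (NDD)**: for every line `R` of `≥ 3` points of `H₀` coplanar with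
the two off-points and every plane `clF (insert c R)` through it (`c ∈ H₀ ∖ clF R`), the points of `H₀` outside that
plane have rank `≥ 3` OR the points of that plane off `clF R` have rank `≥ 3` — no lossy big pair without good points
has both planes degenerate.  The remaining gap of the fat case is the DOUBLY degenerate regime. -/
theorem localShadowHall_fat_of_not_doubly_deg (hG : G ∈ flatsQ M (5 + 1)) (hd : (gr M \ G).card = 2)
    (hk : kColoops M G = 1) (hs : ∀ e ∈ gr M, ∀ f ∈ gr M, e ≠ f → rkN M {e, f} = 2)
    (hl : ∀ e ∈ gr M, M.Indep {e}) (hfat : (fatClosures M 5 G 2).card ≤ 1)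
    {B₀ : Finset α} (hB₀ : B₀ ∈ thinMembers M 5 G) (hm₀ : (G \ clF M B₀).card = 2)
    (hNDD : ∀ R ⊆ (G \ coloops M G) \ (G \ clF M B₀), rkN M R = 2 → 3 ≤ R.card →
      rkN M (R ∪ (G \ clF M B₀)) ≤ 3 → ∀ c ∈ (G \ coloops M G) \ (G \ clF M B₀), c ∉ clF M R →
      3 ≤ rkN M (((G \ coloops M G) \ (G \ clF M B₀)).filter (fun e => e ∉ clF M (insert c R))) ∨
      3 ≤ rkN M (((G \ coloops M G) \ (G \ clF M B₀)).filter (fun e => e ∈ clF M (insert c R) ∧ e ∉ clF M R))) :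
    LocalShadowHall M 5 G := by
  by_cases hgood : ∀ B ∈ thinMembers M 5 G, 5 ≤ (B \ coloops M G).card → ∀ z ∈ G \ clF M B,
      loss M 5 G B z ≠ 0 → (gtPts M 5 G (insert z B)).Nonempty
  · exact localShadowHall_fat_of_good hG hd hk hs hl hfat hB₀ hm₀ hgood
  · obtain ⟨B, hB, hbig, z, hz, hloss, hno⟩ : ∃ B ∈ thinMembers M 5 G, 5 ≤ (B \ coloops M G).card ∧
        ∃ z ∈ G \ clF M B, loss M 5 G B z ≠ 0 ∧ ¬ (gtPts M 5 G (insert z B)).Nonempty := by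
      by_contra hcon
      apply hgood
      intro B hB hbig z hz hloss
      by_contra hno
      exact hcon ⟨B, hB, hbig, z, hz, hloss, hno⟩
    obtain ⟨w₀, x, hne, hD⟩ := Finset.card_eq_two.1 hm₀
    obtain ⟨R₁, hR₁Q, hR₁2, hR₁3, -, hcop, c₂, hc₂Q, c₃, hc₃Q, hc₂, hc₃, hcover⟩ :=
      exists_two_planes_of_no_gtPts hG hd hk hs hl hB₀ hD hB hbig hz hloss hno
    have hGg : G ⊆ gr M := (mem_flatsQ.1 hG).1
    have hQG : insert z B ⊆ G :=
      Finset.insert_subset (Finset.mem_sdiff.1 hz).1 (subset_G_of_mem_thinMembers hB)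
    have hQV : (insert z B \ coloops M G) \ {w₀, x} ⊆ (G \ coloops M G) \ {w₀, x} :=
      Finset.sdiff_subset_sdiff (Finset.sdiff_subset_sdiff hQG (Finset.Subset.refl _)) (Finset.Subset.refl _)
    have hR₁V : R₁ ⊆ (G \ coloops M G) \ {w₀, x} := hR₁Q.trans hQV
    have hc₂V : c₂ ∈ (G \ coloops M G) \ {w₀, x} := hQV hc₂Q
    have hc₃V : c₃ ∈ (G \ coloops M G) \ {w₀, x} := hQV hc₃Q
    have hVg : (G \ coloops M G) \ {w₀, x} ⊆ gr M := fun e he =>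
      hGg (Finset.mem_sdiff.1 (Finset.mem_sdiff.1 he).1).1
    have hR₁g : R₁ ⊆ gr M := hR₁V.trans hVg
    have hc₂g : c₂ ∈ gr M := hVg hc₂V
    have hc₃g : c₃ ∈ gr M := hVg hc₃V
    have hc₃L : c₃ ∉ clF M R₁ := fun h' => hc₃ (clF_mono (Finset.subset_insert _ _) h')
    have hc₂π₃ : c₂ ∉ clF M (insert c₃ R₁) := notMem_clF_insert_of_notMem_clF_insert hR₁g hc₂g hc₃g hc₂ hc₃
    have hcop' : rkN M (R₁ ∪ ({w₀, x} : Finset α)) ≤ 3 := by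
      have heq : R₁ ∪ ({w₀, x} : Finset α) = insert w₀ (insert x R₁) := by
        ext e
        simp only [Finset.mem_union, Finset.mem_insert, Finset.mem_singleton]
        tauto
      rw [heq]
      exact hcop
    rw [hD] at hNDD
    have hfilter : ∀ u v : α, u ∈ gr M → v ∈ gr M → u ∉ clF M R₁ → v ∉ clF M (insert u R₁) →
        (∀ e ∈ (G \ coloops M G) \ {w₀, x}, e ∈ clF M (insert u R₁) ∨ e ∈ clF M (insert v R₁)) →
        ((G \ coloops M G) \ {w₀, x}).filter (fun e => e ∉ clF M (insert u R₁)) =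
          ((G \ coloops M G) \ {w₀, x}).filter (fun e => e ∈ clF M (insert v R₁) ∧ e ∉ clF M R₁) := by
      intro u v hug hvg hu hv hcov
      ext e
      simp only [Finset.mem_filter]
      constructor
      · rintro ⟨heV, heu⟩
        refine ⟨heV, ?_, fun heL => heu (clF_mono (Finset.subset_insert _ _) heL)⟩
        rcases hcov e heV with h | h
        · exact absurd h heu
        · exact h
      · rintro ⟨heV, hev, heL⟩
        refine ⟨heV, fun heu => heL ?_⟩
        exact mem_clF_of_mem_two_planes hR₁g hug hvg hu hv heu hev
    -- (NDD) at the spine and `c₂`: `π₃` off the spine OR `π₂` off the spine has rank `≥ 3`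
    have hdisj := hNDD R₁ hR₁V hR₁2 hR₁3 hcop' c₂ hc₂V hc₂
    rw [hfilter c₂ c₃ hc₂g hc₃g hc₂ hc₃ hcover] at hdisj
    by_cases hnd₂ : 3 ≤ rkN M (((G \ coloops M G) \ {w₀, x}).filter
        (fun e => e ∈ clF M (insert c₂ R₁) ∧ e ∉ clF M R₁))
    · by_cases hnd₃ : 3 ≤ rkN M (((G \ coloops M G) \ {w₀, x}).filter
          (fun e => e ∈ clF M (insert c₃ R₁) ∧ e ∉ clF M R₁))
      · exact localShadowHall_fat_of_two_planes_nondeg hG hd hk hs hl hfat hB₀ hD hne hR₁V hR₁2 hR₁3 hc₂V hc₃V hc₂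
          hc₃ hcover hnd₂ hnd₃
      · exact localShadowHall_fat_of_two_planes_singly_deg hG hd hk hs hl hfat hB₀ hD hne hR₁V hR₁2 hR₁3 hcop hc₂V
          hc₃V hc₂ hc₃ hcover hnd₂ (by omega)
    · -- `π₂` degenerate: then `π₃` is not, by (NDD); swap the roles of the planes
      have hnd₃ : 3 ≤ rkN M (((G \ coloops M G) \ {w₀, x}).filter
          (fun e => e ∈ clF M (insert c₃ R₁) ∧ e ∉ clF M R₁)) := by
        rcases hdisj with h | h
        · exact h
        · exact absurd h hnd₂
      exact localShadowHall_fat_of_two_planes_singly_deg hG hd hk hs hl hfat hB₀ hD hne hR₁V hR₁2 hR₁3 hcop hc₃V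
        hc₂V hc₃L hc₂π₃ (fun e he => (hcover e he).symm) hnd₃ (by omega)

end PercRepro.Shadow
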